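import Literature.AnabelianGeometry.EtaleTheta.Discharge.Sec5Thm56OfBiKummerDataAllLeaves
import Literature.AnabelianGeometry.EtaleTheta.Discharge.Sec5RigidityOfBiKummerDataRoofs
import HarnessLib

/-!
# [EtTh] Prop. 5.5 ⊕ Thm. 5.6 (i) at the assembled §5 data, ALL LEAVES — ROOF FORM (the K4 END-KNIT swap pass, layer 1; proof-only)

S. Mochizuki, *The étale theta function and its Frobenioid-theoretic manifestations*, Publ. RIMS **45** (2009) [MochizukiEtTh2009],
Prop. 5.5 p.327, proof p.328 (PDF p.102) l.2–11 (transport by ROOFS `S″ → S`, `S″ → S′`); Thm. 5.6 p.328, proof p.329 (PDF p.103).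

abc-iut cell, layer L2, seat abc-iut-w5-d013 (gen 6), ruling R571 (abc-iut-L2-lead gen 5, 18:45:16Z: «END-KNIT swap pass on the node closers of
record (K4 (C2) list loses hreach and the all-φ hpull) = GO w5-d013»).  PROOF-ONLY (no definition, no new named fact).  This file is the ROOF TWIN
of abc-iut-w5-d020's `exists_rigidityFamily_unique_preserved_ofBiKummerData_of_leaves` (`Sec5Thm56OfBiKummerDataAllLeaves.lean`, NOT edited) —
the first knit layer above the Prop. 5.5 / Thm. 5.6 theorems at `ofBiKummerData` — consuming this seat's roof twins
`cyclotomicRigidity_ofBiKummerData_of_laws_roofs` / `cyclotomicRigidityPreserved_ofBiKummerData_roofs` (p462110) instead of the fixed-source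
originals; every other producer is consumed BY NAME exactly as in the original (`hconst_ofBiKummerData_of_cnst`, `hcup_iff_pull_root_mul`,
`exists_unit_transports_sameBase_ofBiKummerData`, `lDeltaModNMap_trans_unit`, `biKummerDifferenceMem_ofBiKummerData`, `hYdd_ofBiKummerData_of_prop24`).

BINDER DELTA vs the original (everything else verbatim):
* `hreach : LinearlyReachableFromBN _` (abc-iut-L2-t4's fixed-source transport step; a DEPTH constraint over `B^temp(Π)⁰`, F-w5d013g5-1; FACT
  row F-0735, class refuted-closure, c312-2 CONE-K4-RECLOSE v4 row EtTh:Prop5.5) ↦ print's roofs `hroof` (one roof `B_N ⟵b R a⟶ T` of linear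
  morphisms from a theta-saturated `R` per theta-saturated `T`, legs onto on `(l·Δ_Θ) ⊗ ℤ/Nℤ` and injective on `μ_N`) + `hmeet` (two roofs of
  `T` meet at a theta-saturated `R₀` over one base map);
* `hGalT` (base law «a Galois object is an `Aut`-torsor over every target», abc-iut-w4-d099) ↦ `hGalIn` («… under every SOURCE» = [SemiAnbd]
  Def. 3.1 (iv) VERBATIM; a THEOREM over `B^temp(Π)⁰`: `GaloisObjects.exists_comp_aut_eq_of_isGaloisObj_connectedPart`, p460420), transported
  from the Galois `N`-domain `A_N^bs` (Def. 4.1 (iv)(a)) to `B_N^bs` along `(s^⊓_N)^bs` (`baseTorsorIn_ofBiKummerData_of_galoisHomTorsorIn`);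
* abc-iut-L2-d4's `hpull` ↦ its clause at LINEAR `φ` (the only use; a THEOREM at the genuine data, p449195).
HONEST FRAMING: kernel-checked implications between typed statements about the assembled §5 data; the roofs, their meeting, `P :
ThetaSubquotientProj 𝔉` and the other binders are HYPOTHESES, not asserted; nothing asserts that such data exist for an actual curve;
[EtTh]/[SemiAnbd] are refereed pre-IUT material; nothing here bears on [IUTchIII] Cor. 3.12 — no side is taken; typed ≠ proved.
-/

noncomputable section

namespace Literature.AnabelianGeometry.EtaleTheta

open CategoryTheory Opposite FrobenioidCyclotomicRigidity Literature.AlgebraicGeometry.Frobenioids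

universe u₀ v₀ u v w v₁ u₁

namespace ThetaFrobenioid

variable {K : Type u₀} [Field K]
  {X : SemiGraphs.TemperedArithmeticGroup.{u₀} K} {D₀ : Type u₀} [Category.{v₀} D₀]
  {V : FrdIMonoidStub.{w}} {T₀ : RealifiedDivisorMonoids (D₀ := D₀) V} {D : Type u} [Category.{v} D]
  {VD : FrdICatStub.{u, v, w} D} {S : BiKummerSetting X T₀ D VD}
  {pullFrac : ∀ {A A' : S.C} (_ : A' ⟶ A), S.biratUnits A → S.biratUnits A'}
  {lv N : ℕ+} {l' : ℕ} {RD : RigidData.{max v w} N l'} {θ : S.biratUnits S.Aodot} {Bl : S.C}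
  {Pl : S.FractionPair θ Bl} {Rl : S.NthRoot θ Pl lv pullFrac}
  (h : ModelFrobenioid.Hypotheses S.tf.divisorMonoid S.tf.ratFnFunctor)
  (toB : ∀ A : S.C, S.biratUnits A →* S.tf.biratUnitsModel A) (Q : FrobenioidTheta.ThetaSubquotientStub.{w} D)
  (odd_l : Odd (lv : ℕ)) (R : S.NthRoot Rl.root Rl.pair N pullFrac) (ιX : RD.PiX ≃ₜ* X.Pi)
  (hopen : IsOpen ((S.galoisSurj R.AN.base R.αData.isGalois).ker : Set X.Pi)) (σ : Aut R.AN.base →* Aut R.AN)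
  (K' : Type w) [Field K'] (constEmb : K'ˣ →* S.tf.biratUnitsModel R.BN)
  (constEmb_injective : Function.Injective constEmb)
  (hdivc : ∀ g : Aut R.BN.base,
    ModelFrobenioid.div ((σ ((BiKummerSetting.NthRoot.baseIso S R).conjAut.symm g)).hom ≫ R.pair.num) =
      ModelFrobenioid.div R.pair.num)
  (hdivp : ∀ y : RD.PiYdd,
    ModelFrobenioid.div ((σ (S.galoisSurj R.AN.base R.αData.isGalois (ιX y.1))).hom ≫ R.pair.den) =
      ModelFrobenioid.div R.pair.den)

/-! ### (G-in) at `B_N^bs` from the base law «a Galois object is an `Aut`-torsor under every source» -/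

/-- **(G-in) at `B_N^bs` from the base law at the Galois `N`-domain `A_N^bs`** (Def. 4.1 (iv)(a): `A_N` is Galois; `(s^⊓_N)^bs : A_N^bs ⥲
B_N^bs`): if for every Galois `A` and every source `T` two arrows `T ⟶ A` differ by POST-composition with an automorphism of `A` (binder
`hGalIn` — [SemiAnbd] Def. 3.1 (iv) verbatim), then the base arrows of ANY two `φ, φ′ : T ⟶ B_N` of `C` differ so: `φ′^bs = φ^bs ≫ g`.  The
in-direction twin of abc-iut-w4-d099's `baseTorsor_ofBiKummerData_of_galoisHomTorsor`.
[cite: MochizukiEtTh2009, Def 4.1 (ii) p.313 (PDF p.87); Prop 5.5 proof p.328 (PDF p.102)] [cite: MochizukiSemiAnbd2006, Def 3.1(iv) p.33] -/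
theorem baseTorsorIn_ofBiKummerData_of_galoisHomTorsorIn
    (hGalIn : ∀ ⦃A : D⦄, S.IsGaloisObj A → ∀ ⦃T : D⦄ (b b' : T ⟶ A), ∃ g : Aut A, b' = b ≫ g.hom)
    (T : S.C) (φ φ' : T ⟶ (ofBiKummerData h toB Q odd_l R ιX hopen σ K' constEmb constEmb_injective hdivc hdivp).BN) :
    ∃ g : Aut ((ofBiKummerData h toB Q odd_l R ιX hopen σ K' constEmb constEmb_injective hdivc hdivp).base.obj (ofBiKummerData h toB Q odd_l R ιX hopen σ K' constEmb constEmb_injective hdivc hdivp).BN), (ofBiKummerData h toB Q odd_l R ιX hopen σ K' constEmb constEmb_injective hdivc hdivp).base.map φ' = (ofBiKummerData h toB Q odd_l R ιX hopen σ K' constEmb constEmb_injective hdivc hdivp).base.map φ ≫ g.hom := by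
  change ∃ g : Aut R.BN.base, ModelFrobenioid.baseMap φ' = ModelFrobenioid.baseMap φ ≫ g.hom
  obtain ⟨g, hg⟩ := hGalIn R.αData.isGalois (ModelFrobenioid.baseMap φ ≫ (BiKummerSetting.NthRoot.baseIso S R).inv)
    (ModelFrobenioid.baseMap φ' ≫ (BiKummerSetting.NthRoot.baseIso S R).inv)
  refine ⟨(BiKummerSetting.NthRoot.baseIso S R).conjAut g, ?_⟩
  have hg' := ((BiKummerSetting.NthRoot.baseIso S R).comp_inv_eq).mp hg
  simp only [Category.assoc] at hg'
  rw [Iso.conjAut_hom, Iso.conj_apply]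
  exact hg'

/-- **The binder `hgalIn` of `cyclotomicRigidity_ofBiKummerData_of_laws_roofs`, DERIVED from the base law (G-in)** — in exactly that binder's
shape (theta-saturated source, linear `φ, φ′`; both premises idle).  [cite: MochizukiEtTh2009, Prop 5.5 proof p.328 (PDF p.102)] -/
theorem linearBaseTorsorIn_ofBiKummerData_of_galoisHomTorsorIn
    (hGalIn : ∀ ⦃A : D⦄, S.IsGaloisObj A → ∀ ⦃T : D⦄ (b b' : T ⟶ A), ∃ g : Aut A, b' = b ≫ g.hom) :
    ∀ (T : S.C), (ofBiKummerData h toB Q odd_l R ιX hopen σ K' constEmb constEmb_injective hdivc hdivp).IsThetaSaturated T → ∀ (φ φ' : T ⟶ (ofBiKummerData h toB Q odd_l R ιX hopen σ K' constEmb constEmb_injective hdivc hdivp).BN), (ofBiKummerData h toB Q odd_l R ιX hopen σ K' constEmb constEmb_injective hdivc hdivp).IsLinear φ → (ofBiKummerData h toB Q odd_l R ιX hopen σ K' constEmb constEmb_injective hdivc hdivp).IsLinear φ' →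
      ∃ g : Aut ((ofBiKummerData h toB Q odd_l R ιX hopen σ K' constEmb constEmb_injective hdivc hdivp).base.obj (ofBiKummerData h toB Q odd_l R ιX hopen σ K' constEmb constEmb_injective hdivc hdivp).BN), (ofBiKummerData h toB Q odd_l R ιX hopen σ K' constEmb constEmb_injective hdivc hdivp).base.map φ' = (ofBiKummerData h toB Q odd_l R ιX hopen σ K' constEmb constEmb_injective hdivc hdivp).base.map φ ≫ g.hom :=
  fun T _ φ φ' _ _ =>
    baseTorsorIn_ofBiKummerData_of_galoisHomTorsorIn h toB Q odd_l R ιX hopen σ K' constEmb constEmb_injective hdivc hdivp hGalIn T φ φ'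

/-! ### The all-leaves knit, roof form -/

/-- **[EtTh] Prop. 5.5 ⊕ Thm. 5.6 (i) AT THE ASSEMBLED §5 DATA — ALL LANDED LEAVES PLUGGED, ROOF FORM**: abc-iut-w5-d020's
`exists_rigidityFamily_unique_preserved_ofBiKummerData_of_leaves` with `hreach ↦ {hroof, hmeet}`, `hGalT ↦ hGalIn`, `hpull` linear-only (module
docstring) — there is a UNIQUE rigidity family `ρ`, Kummer-determined on `B_N` through `P` and functorial for linear morphisms (Prop. 5.5), and every
self-equivalence `Ψ` with the listed transport data PRESERVES `ρ` (Thm. 5.6).  Composition exactly as the original: Prop. 5.5 at the data in roof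
form (`cyclotomicRigidity_ofBiKummerData_of_laws_roofs`, (G-in) := `hGalIn`, `hcup` := abc-iut-L6-t23's pull-root law, `hconst` := abc-iut-w5-d020's
`hconst_ofBiKummerData_of_cnst`), then Thm. 5.6 at the data in roof form (`cyclotomicRigidityPreserved_ofBiKummerData_roofs`) with the transports of
`exists_unit_transports_sameBase_ofBiKummerData`, `hYdd` := abc-iut-w5-d245's `hYdd_ofBiKummerData_of_prop24`, `hdiff` := abc-iut-L2-t4's
`biKummerDifferenceMem_ofBiKummerData`, `haΨ` transported along the unit renormalisation of `β`.
[cite: MochizukiEtTh2009, Prop 5.5 p.327 (PDF p.101); Thm 5.6 p.328 (PDF p.102)] -/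
theorem exists_rigidityFamily_unique_preserved_ofBiKummerData_of_leaves_roofs
    -- Prop 5.5 side (η / ν pin, reachability, stub laws)
    (hB : (ofBiKummerData h toB Q odd_l R ιX hopen σ K' constEmb constEmb_injective hdivc hdivp).IsThetaSaturated (ofBiKummerData h toB Q odd_l R ιX hopen σ K' constEmb constEmb_injective hdivc hdivp).BN) (P : ThetaSubquotientProj (ofBiKummerData h toB Q odd_l R ιX hopen σ K' constEmb constEmb_injective hdivc hdivp))
    {η₀ : RD.PiYdd → RD.mu} (hη₀ : η₀ ∈ RD.thetaCocycles)
    (hdies : ∀ k : RD.PiYdd, rhoOfBiKummerData R ιX k = 1 → η₀ k = 1)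
    (e : RD.mu → (ofBiKummerData h toB Q odd_l R ιX hopen σ K' constEmb constEmb_injective hdivc hdivp).lDeltaModN (ofBiKummerData h toB Q odd_l R ιX hopen σ K' constEmb constEmb_injective hdivc hdivp).BN) (he : Function.Surjective e)
    (hpre : ∀ k : RD.PiYdd, (k : RD.PiX) ∈ RD.lDeltaTheta → rhoOfBiKummerData R ιX k ∈ P.pre _)
    (hP : ∀ (k : RD.PiYdd) (hk : (k : RD.PiX) ∈ RD.lDeltaTheta) (hm : rhoOfBiKummerData R ιX k ∈ P.pre _),
      (QuotientGroup.mk (P.proj _ ⟨rhoOfBiKummerData R ιX k, hm⟩) : (ofBiKummerData h toB Q odd_l R ιX hopen σ K' constEmb constEmb_injective hdivc hdivp).lDeltaModN (ofBiKummerData h toB Q odd_l R ιX hopen σ K' constEmb constEmb_injective hdivc hdivp).BN) = e (RD.thetaMod ⟨k, hk⟩))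
    (hcov' : ∀ g ∈ P.pre ((ofBiKummerData h toB Q odd_l R ιX hopen σ K' constEmb constEmb_injective hdivc hdivp).base.obj (ofBiKummerData h toB Q odd_l R ιX hopen σ K' constEmb constEmb_injective hdivc hdivp).BN), ∃ k : RD.PiYdd, (k : RD.PiX) ∈ RD.lDeltaTheta ∧ rhoOfBiKummerData R ιX k = g)
    (ν : (ofBiKummerData h toB Q odd_l R ιX hopen σ K' constEmb constEmb_injective hdivc hdivp).lDeltaModN (ofBiKummerData h toB Q odd_l R ιX hopen σ K' constEmb constEmb_injective hdivc hdivp).BN ≃* (ofBiKummerData h toB Q odd_l R ιX hopen σ K' constEmb constEmb_injective hdivc hdivp).muTorsion (ofBiKummerData h toB Q odd_l R ιX hopen σ K' constEmb constEmb_injective hdivc hdivp).BN (ofBiKummerData h toB Q odd_l R ιX hopen σ K' constEmb constEmb_injective hdivc hdivp).N)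
    (hKν : ∀ η : (ofBiKummerData h toB Q odd_l R ιX hopen σ K' constEmb constEmb_injective hdivc hdivp).HB → (ofBiKummerData h toB Q odd_l R ιX hopen σ K' constEmb constEmb_injective hdivc hdivp).lDeltaModN (ofBiKummerData h toB Q odd_l R ιX hopen σ K' constEmb constEmb_injective hdivc hdivp).BN,
      (∀ k : RD.PiYdd, η ⟨rhoOfBiKummerData R ιX k, Subgroup.mem_map_of_mem _ k.2⟩ = e (η₀ k)) →
        FrobenioidThetaBiKummer.ThetaPairKummerClass (ofBiKummerData h toB Q odd_l R ιX hopen σ K' constEmb constEmb_injective hdivc hdivp) η ν)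
    (hσ : ∀ g : Aut R.AN.base, ModelFrobenioid.baseMap (σ g).hom = g.hom)
    (hgeom : P.pre R.BN.base ≤ RD.aug.ker.map (rhoOfBiKummerData R ιX))
    -- T56-L09b: Prop 3.4 (ii) constants + the origin clause «cnst kills Ker aug» (G-w5d020-2)
    {Dcnst : Type u₁} [Category.{v₁} Dcnst] {cnst : D₀ ⥤ Dcnst} (hP34 : RealifiedDivisorMonoids.Prop34Cnst T₀ cnst)
    (hΔcnst : ∀ δ ∈ RD.aug.ker,
      cnst.map (S.tf.base.map (rhoOfBiKummerData R ιX δ).hom) = 𝟙 (cnst.obj (S.tf.base.obj R.BN.base)))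
    -- print's ROOFS (replacing `hreach`): one roof per theta-saturated object, and two roofs of `T` meet
    (hroof : ∀ T : S.C, (ofBiKummerData h toB Q odd_l R ιX hopen σ K' constEmb constEmb_injective hdivc hdivp).IsThetaSaturated T →
      ∃ (R' : S.C) (_ : (ofBiKummerData h toB Q odd_l R ιX hopen σ K' constEmb constEmb_injective hdivc hdivp).IsThetaSaturated R') (a : R' ⟶ T) (b : R' ⟶ (ofBiKummerData h toB Q odd_l R ιX hopen σ K' constEmb constEmb_injective hdivc hdivp).BN),
        (ofBiKummerData h toB Q odd_l R ιX hopen σ K' constEmb constEmb_injective hdivc hdivp).IsLinear a ∧ (ofBiKummerData h toB Q odd_l R ιX hopen σ K' constEmb constEmb_injective hdivc hdivp).IsLinear b ∧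
        Function.Surjective ((ofBiKummerData h toB Q odd_l R ιX hopen σ K' constEmb constEmb_injective hdivc hdivp).lDeltaModNMap a) ∧ Function.Injective ((ofBiKummerData h toB Q odd_l R ιX hopen σ K' constEmb constEmb_injective hdivc hdivp).muTorsionPull a (ofBiKummerData h toB Q odd_l R ιX hopen σ K' constEmb constEmb_injective hdivc hdivp).N) ∧
        Function.Surjective ((ofBiKummerData h toB Q odd_l R ιX hopen σ K' constEmb constEmb_injective hdivc hdivp).lDeltaModNMap b) ∧ Function.Injective ((ofBiKummerData h toB Q odd_l R ιX hopen σ K' constEmb constEmb_injective hdivc hdivp).muTorsionPull b (ofBiKummerData h toB Q odd_l R ιX hopen σ K' constEmb constEmb_injective hdivc hdivp).N))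
    (hmeet : ∀ (T : S.C), (ofBiKummerData h toB Q odd_l R ιX hopen σ K' constEmb constEmb_injective hdivc hdivp).IsThetaSaturated T →
      ∀ (R₁ : S.C), (ofBiKummerData h toB Q odd_l R ιX hopen σ K' constEmb constEmb_injective hdivc hdivp).IsThetaSaturated R₁ → ∀ (a : R₁ ⟶ T), (ofBiKummerData h toB Q odd_l R ιX hopen σ K' constEmb constEmb_injective hdivc hdivp).IsLinear a →
      ∀ (R₂ : S.C), (ofBiKummerData h toB Q odd_l R ιX hopen σ K' constEmb constEmb_injective hdivc hdivp).IsThetaSaturated R₂ → ∀ (a' : R₂ ⟶ T), (ofBiKummerData h toB Q odd_l R ιX hopen σ K' constEmb constEmb_injective hdivc hdivp).IsLinear a' →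
      ∃ (R₀ : S.C) (_ : (ofBiKummerData h toB Q odd_l R ιX hopen σ K' constEmb constEmb_injective hdivc hdivp).IsThetaSaturated R₀) (c : R₀ ⟶ R₁) (c' : R₀ ⟶ R₂),
        (ofBiKummerData h toB Q odd_l R ιX hopen σ K' constEmb constEmb_injective hdivc hdivp).IsLinear c ∧ (ofBiKummerData h toB Q odd_l R ιX hopen σ K' constEmb constEmb_injective hdivc hdivp).IsLinear c' ∧ (ofBiKummerData h toB Q odd_l R ιX hopen σ K' constEmb constEmb_injective hdivc hdivp).base.map (c ≫ a) = (ofBiKummerData h toB Q odd_l R ιX hopen σ K' constEmb constEmb_injective hdivc hdivp).base.map (c' ≫ a') ∧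
        Function.Surjective ((ofBiKummerData h toB Q odd_l R ιX hopen σ K' constEmb constEmb_injective hdivc hdivp).lDeltaModNMap c') ∧ Function.Injective ((ofBiKummerData h toB Q odd_l R ιX hopen σ K' constEmb constEmb_injective hdivc hdivp).muTorsionPull c' (ofBiKummerData h toB Q odd_l R ιX hopen σ K' constEmb constEmb_injective hdivc hdivp).N))
    (hLc : Thm56Sub.LDeltaMapComp (ofBiKummerData h toB Q odd_l R ιX hopen σ K' constEmb constEmb_injective hdivc hdivp)) (hLi : Thm56Sub.LDeltaMapId (ofBiKummerData h toB Q odd_l R ιX hopen σ K' constEmb constEmb_injective hdivc hdivp))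
    -- P55-L06 leaves: (G-in) as the base law «a Galois object is an `Aut`-torsor under every SOURCE», hproj named, hcup as the pull-root law
    (hGalIn : ∀ ⦃A : D⦄, S.IsGaloisObj A → ∀ ⦃T : D⦄ (b b' : T ⟶ A), ∃ g : Aut A, b' = b ≫ g.hom)
    (hproj : ∀ (g g' : Aut ((ofBiKummerData h toB Q odd_l R ιX hopen σ K' constEmb constEmb_injective hdivc hdivp).base.obj (ofBiKummerData h toB Q odd_l R ιX hopen σ K' constEmb constEmb_injective hdivc hdivp).BN)) (hh : g' ∈ P.pre _), ∃ hgh : g * g' * g⁻¹ ∈ P.pre _,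
      (ofBiKummerData h toB Q odd_l R ιX hopen σ K' constEmb constEmb_injective hdivc hdivp).lDeltaMap g.hom (P.proj _ ⟨g', hh⟩) = P.proj _ ⟨g * g' * g⁻¹, hgh⟩)
    (hKR : ∀ (y₀ y : RD.PiX), y ∈ RD.PiYdd → rhoOfBiKummerData R ιX y ∈ P.pre R.BN.base →
      pull S.tf.ratFnFunctor (S.galoisSurj R.AN.base R.αData.isGalois (ιX y)).hom
          (pull S.tf.ratFnFunctor (S.galoisSurj R.AN.base R.αData.isGalois (ιX y₀)).hom
            (toB R.AN R.root : S.tf.ratFnFunctor.obj (op R.AN.base))) *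
          (toB R.AN R.root : S.tf.ratFnFunctor.obj (op R.AN.base)) =
        pull S.tf.ratFnFunctor (S.galoisSurj R.AN.base R.αData.isGalois (ιX y)).hom
            (toB R.AN R.root : S.tf.ratFnFunctor.obj (op R.AN.base)) *
          pull S.tf.ratFnFunctor (S.galoisSurj R.AN.base R.αData.isGalois (ιX y₀)).hom
            (toB R.AN R.root : S.tf.ratFnFunctor.obj (op R.AN.base)))
    -- t4's inputs discharging hdiff ([FrdI] Prop 5.6 section law, Π^tp_Ÿ ⊆ H_⊙, Thm 5.2 (ii) dictionary)
    (hH : ∀ y : RD.PiX, y ∈ RD.PiYdd → ιX y ∈ S.Hodot)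
    (hfrac : ∀ {A B : S.C} (s' s'' : A ⟶ B) (h' : S.IsPreStep s') (h'' : S.IsPreStep s'')
      (hb : PreFrobenioid.BaseEquivalent S.F s' s''),
      (toB A (S.fracOf s' s'' h' h'' hb) : S.tf.ratFnFunctor.obj (op A.base)) *
        ModelFrobenioid.unit s'' = ModelFrobenioid.unit s')
    (haut : ∀ {A : S.C} (e : Aut A) (x : S.biratUnits A),
      (toB A (S.biratAut A e x) : S.tf.ratFnFunctor.obj (op A.base)) =
        pull S.tf.ratFnFunctor (ModelFrobenioid.baseMap e.inv) (toB A x : S.tf.ratFnFunctor.obj (op A.base)))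
    -- Thm 5.6 side: Ψ, its base shadow, Δ-transport and μ-pull data (abc-iut-L2-d4)
    (Ψ : S.C ≌ S.C) (Ψbs : D ⥤ D) [Ψbs.Faithful] (eΨ : Ψ.functor ⋙ (ofBiKummerData h toB Q odd_l R ιX hopen σ K' constEmb constEmb_injective hdivc hdivp).base ≅ (ofBiKummerData h toB Q odd_l R ιX hopen σ K' constEmb constEmb_injective hdivc hdivp).base ⋙ Ψbs)
    (aΨ : ∀ A : S.C, (ofBiKummerData h toB Q odd_l R ιX hopen σ K' constEmb constEmb_injective hdivc hdivp).lDeltaModN A ≃* (ofBiKummerData h toB Q odd_l R ιX hopen σ K' constEmb constEmb_injective hdivc hdivp).lDeltaModN (Ψ.functor.obj A))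
    (hlin : PreFrobenioidData.PreservesMor Ψ.functor (ofBiKummerData h toB Q odd_l R ιX hopen σ K' constEmb constEmb_injective hdivc hdivp).IsLinear (ofBiKummerData h toB Q odd_l R ιX hopen σ K' constEmb constEmb_injective hdivc hdivp).IsLinear)
    (haΨn : ∀ {A A' : S.C} (φ : A ⟶ A') (x : (ofBiKummerData h toB Q odd_l R ιX hopen σ K' constEmb constEmb_injective hdivc hdivp).lDeltaModN A),
      aΨ A' ((ofBiKummerData h toB Q odd_l R ιX hopen σ K' constEmb constEmb_injective hdivc hdivp).lDeltaModNMap φ x) = (ofBiKummerData h toB Q odd_l R ιX hopen σ K' constEmb constEmb_injective hdivc hdivp).lDeltaModNMap (Ψ.functor.map φ) (aΨ A x))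
    (hpull : ∀ {A A' : S.C} (φ : A ⟶ A'), (ofBiKummerData h toB Q odd_l R ιX hopen σ K' constEmb constEmb_injective hdivc hdivp).IsLinear φ → ∀ (u : (ofBiKummerData h toB Q odd_l R ιX hopen σ K' constEmb constEmb_injective hdivc hdivp).muTorsion A' (ofBiKummerData h toB Q odd_l R ιX hopen σ K' constEmb constEmb_injective hdivc hdivp).N)
      (hu : Ψ.functor.mapAut A' (u : Aut A') ∈ (ofBiKummerData h toB Q odd_l R ιX hopen σ K' constEmb constEmb_injective hdivc hdivp).muTorsion (Ψ.functor.obj A') (ofBiKummerData h toB Q odd_l R ιX hopen σ K' constEmb constEmb_injective hdivc hdivp).N),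
      Ψ.functor.mapAut A ((ofBiKummerData h toB Q odd_l R ιX hopen σ K' constEmb constEmb_injective hdivc hdivp).muTorsionPull φ (ofBiKummerData h toB Q odd_l R ιX hopen σ K' constEmb constEmb_injective hdivc hdivp).N u : Aut A) = ((ofBiKummerData h toB Q odd_l R ιX hopen σ K' constEmb constEmb_injective hdivc hdivp).muTorsionPull (Ψ.functor.map φ) (ofBiKummerData h toB Q odd_l R ιX hopen σ K' constEmb constEmb_injective hdivc hdivp).N ⟨_, hu⟩ : Aut (Ψ.functor.obj A)))
    -- the NORMALISED Thm 5.7 transport (D_c = 1, e = 1: abc-iut-L2-d4 T1 + abc-iut-w5-d245 `capCupTransport_normalise`)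
    (α : Ψ.functor.obj (ofBiKummerData h toB Q odd_l R ιX hopen σ K' constEmb constEmb_injective hdivc hdivp).AN ≅ (ofBiKummerData h toB Q odd_l R ιX hopen σ K' constEmb constEmb_injective hdivc hdivp).AN) (β : Ψ.functor.obj (ofBiKummerData h toB Q odd_l R ιX hopen σ K' constEmb constEmb_injective hdivc hdivp).BN ≅ (ofBiKummerData h toB Q odd_l R ιX hopen σ K' constEmb constEmb_injective hdivc hdivp).BN) {Dp₀ : Aut (ofBiKummerData h toB Q odd_l R ιX hopen σ K' constEmb constEmb_injective hdivc hdivp).BN}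
    (hc₁ : α.inv ≫ Ψ.functor.map (ofBiKummerData h toB Q odd_l R ιX hopen σ K' constEmb constEmb_injective hdivc hdivp).sCap ≫ β.hom = (ofBiKummerData h toB Q odd_l R ιX hopen σ K' constEmb constEmb_injective hdivc hdivp).sCap)
    (hp₁ : α.inv ≫ Ψ.functor.map (ofBiKummerData h toB Q odd_l R ιX hopen σ K' constEmb constEmb_injective hdivc hdivp).sCup ≫ β.hom = (ofBiKummerData h toB Q odd_l R ιX hopen σ K' constEmb constEmb_injective hdivc hdivp).sCup ≫ Dp₀.hom) (hDp₀ : Dp₀ ∈ (ofBiKummerData h toB Q odd_l R ιX hopen σ K' constEmb constEmb_injective hdivc hdivp).units (ofBiKummerData h toB Q odd_l R ιX hopen σ K' constEmb constEmb_injective hdivc hdivp).BN)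
    -- [FrdI] Prop 5.6 / Thm 3.4 (iii) data at A_N (abc-iut-w5-d245's Prop 5.6 unit)
    (φ : ℕ+ →* End R.AN)
    (hφ : ∀ n : ℕ+, PreFrobenioid.degFr S.F (End.asHom (φ n)) = n ∧
      PreFrobenioid.IsBaseIdentity S.F (End.asHom (φ n)) ∧ PreFrobenioid.IsFrobeniusType S.F (End.asHom (φ n)))
    (hc : ∀ (n : ℕ+) (g : Aut R.AN.base), (σ g).hom ≫ End.asHom (φ n) = End.asHom (φ n) ≫ (σ g).hom)
    (θA : Aut R.AN.base ≃* Aut R.AN.base)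
    (hθ : ∀ f : Aut R.AN, (PreFrobenioid.baseFunctor S.F).mapIso (α.symm ≪≫ Ψ.functor.mapIso f ≪≫ α) =
      θA ((PreFrobenioid.baseFunctor S.F).mapIso f))
    (ΨN : ℕ+ ≃* ℕ+)
    (hdeg : ∀ f : R.AN ⟶ R.AN, PreFrobenioid.degFr S.F (α.inv ≫ Ψ.functor.map f ≫ α.hom) = ΨN (PreFrobenioid.degFr S.F f))
    (hbi : ∀ f : R.AN ⟶ R.AN, PreFrobenioid.IsBaseIdentity S.F f →
      PreFrobenioid.IsBaseIdentity S.F (α.inv ≫ Ψ.functor.map f ≫ α.hom))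
    (hft : ∀ f : R.AN ⟶ R.AN, PreFrobenioid.IsFrobeniusType S.F f →
      PreFrobenioid.IsFrobeniusType S.F (α.inv ≫ Ψ.functor.map f ≫ α.hom))
    -- Prop 2.4 for the Galois shadow of θ_B (abc-iut-w5-d245's hYdd reduction) and T56-L09c
    (γ : RD.PiX ≃ₜ* RD.PiX)
    (hγ : ∀ y : RD.PiX, (((ofBiKummerData h toB Q odd_l R ιX hopen σ K' constEmb constEmb_injective hdivc hdivp).autBaseIsoAB.symm.trans θA).trans (ofBiKummerData h toB Q odd_l R ιX hopen σ K' constEmb constEmb_injective hdivc hdivp).autBaseIsoAB) (rhoOfBiKummerData R ιX y) =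
      rhoOfBiKummerData R ιX (γ y))
    (hP24 : RD.PiYdd.map γ.toMulEquiv.toMonoidHom = RD.PiYdd)
    (hγL : RD.lDeltaTheta.map γ.toMulEquiv.toMonoidHom = RD.lDeltaTheta)
    (haΨ : ∀ (k : RD.PiYdd) (hk : (k : RD.PiX) ∈ RD.lDeltaTheta) (hk' : γ k ∈ RD.lDeltaTheta),
      (ofBiKummerData h toB Q odd_l R ιX hopen σ K' constEmb constEmb_injective hdivc hdivp).lDeltaModNMap β.hom (aΨ _ (e (RD.thetaMod ⟨k, hk⟩))) = e (RD.thetaMod ⟨γ k, hk'⟩)) :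
    ∃ ρ : RigidityFamily (ofBiKummerData h toB Q odd_l R ιX hopen σ K' constEmb constEmb_injective hdivc hdivp), IsKummerDetermined (ofBiKummerData h toB Q odd_l R ιX hopen σ K' constEmb constEmb_injective hdivc hdivp) P ρ hB ∧ IsFunctorialLinear (ofBiKummerData h toB Q odd_l R ιX hopen σ K' constEmb constEmb_injective hdivc hdivp) ρ ∧
      (∀ ρ' : RigidityFamily (ofBiKummerData h toB Q odd_l R ιX hopen σ K' constEmb constEmb_injective hdivc hdivp), IsKummerDetermined (ofBiKummerData h toB Q odd_l R ιX hopen σ K' constEmb constEmb_injective hdivc hdivp) P ρ' hB → IsFunctorialLinear (ofBiKummerData h toB Q odd_l R ιX hopen σ K' constEmb constEmb_injective hdivc hdivp) ρ' → ρ' = ρ) ∧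
      CyclotomicRigidityPreserved (ofBiKummerData h toB Q odd_l R ιX hopen σ K' constEmb constEmb_injective hdivc hdivp) Ψ ρ aΨ := by
  -- T56-L09b: the units are constants (Prop 3.4 (ii)), geometric automorphisms die in `D^cnst`
  have hconst := hconst_ofBiKummerData_of_cnst (T := RD.toThetaEnvData) h R ιX hP34 hΔcnst
  -- P55-L06c: the `s^⊔-gp` conjugation law from the pull-root law (abc-iut-L6-t23)
  have hcup := (hcup_iff_pull_root_mul h toB Q odd_l R ιX hopen σ K' constEmb constEmb_injective hdivc hdivp hσ hfrac P).mpr hKR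
  -- Prop 5.5 at the data in ROOF form, (G-in) := hGalIn
  obtain ⟨⟨ρ, hK, hρ⟩, huniq⟩ := cyclotomicRigidity_ofBiKummerData_of_laws_roofs h toB Q odd_l R ιX hopen σ K' constEmb constEmb_injective hdivc hdivp hB P hη₀ hdies e he
    (fun a _ ha => hcov' a ha) hpre hP ν hKν hσ hgeom hconst hroof hmeet hLc hLi
    (linearBaseTorsorIn_ofBiKummerData_of_galoisHomTorsorIn h toB Q odd_l R ιX hopen σ K' constEmb constEmb_injective hdivc hdivp hGalIn) hproj hcup
  refine ⟨ρ, hK, hρ, fun ρ' hK' hρ' => (huniq ρ ρ' hK hρ hK' hρ').symm, ?_⟩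
  -- the transports with ONE unit and the same base arrow for β
  obtain ⟨eA, -, u', Dp, hDp, hT, hT', hstrv⟩ := exists_unit_transports_sameBase_ofBiKummerData h toB Q odd_l R ιX hopen σ K' constEmb constEmb_injective hdivc hdivp hσ φ hφ hc Ψ α β θA
    hθ ΨN hdeg hbi hft hc₁ hp₁ hDp₀
  -- T56-L09c binder transported along the unit renormalisation of β (same base arrow)
  have haΨ' : ∀ (k : RD.PiYdd) (hk : (k : RD.PiX) ∈ RD.lDeltaTheta) (hk' : γ k ∈ RD.lDeltaTheta),
      (ofBiKummerData h toB Q odd_l R ιX hopen σ K' constEmb constEmb_injective hdivc hdivp).lDeltaModNMap (β ≪≫ (u' : Aut (ofBiKummerData h toB Q odd_l R ιX hopen σ K' constEmb constEmb_injective hdivc hdivp).BN)).hom (aΨ _ (e (RD.thetaMod ⟨k, hk⟩))) = e (RD.thetaMod ⟨γ k, hk'⟩) :=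
    fun k hk hk' => ((ofBiKummerData h toB Q odd_l R ιX hopen σ K' constEmb constEmb_injective hdivc hdivp).lDeltaModNMap_trans_unit β u' _).trans (haΨ k hk hk')
  exact cyclotomicRigidityPreserved_ofBiKummerData_roofs h toB Q odd_l R ιX hopen σ K' constEmb constEmb_injective hdivc hdivp Ψ Ψbs eΨ α (β ≪≫ (u' : Aut (ofBiKummerData h toB Q odd_l R ιX hopen σ K' constEmb constEmb_injective hdivc hdivp).BN)) eA Dp
    (((ofBiKummerData h toB Q odd_l R ιX hopen σ K' constEmb constEmb_injective hdivc hdivp).autBaseIsoAB.symm.trans θA).trans (ofBiKummerData h toB Q odd_l R ιX hopen σ K' constEmb constEmb_injective hdivc hdivp).autBaseIsoAB) aΨ hlin haΨn hpull hroof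
    (biKummerDifferenceMem_ofBiKummerData h toB Q odd_l R ιX hopen σ K' constEmb constEmb_injective hdivc hdivp hσ hH hfrac haut)
    hT hT' hDp hstrv (hYdd_ofBiKummerData_of_prop24 h toB Q odd_l R ιX hopen σ K' constEmb constEmb_injective hdivc hdivp _ γ hγ hP24) P hσ hgeom hconst e he hpre hP hcov' γ hγ hγL haΨ'
    ρ hB hK hρ

end ThetaFrobenioid

end Literature.AnabelianGeometry.EtaleTheta

end
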